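import Mathlib
import HarnessLib
import Summits.NavierStokesRegularity.NavierStokesRegularity.Theorems.PoloidalWindowDoorLrcModEntireRidgeGlobalBranchLocal

/-!
# Item `LrcModEntire` (stmt-NavierStokesRegularity-20428) — BRANCH-PARAM, part 7: local uniqueness of the hot arc, and EVERY good curve solves the hot-branch ODE

LEAD of item 20428 ns-poloidal-K2-p3 g15 (`--supports stmt-NavierStokesRegularity-20428 --as helper`).  Two class-free tools for the global topology of non-degenerate
hot branches (`…RidgeGlobalBranchProper`: injectivity and properness):

* `hotSet_subset_curve` — LOCAL UNIQUENESS: if a `C¹` unit-speed curve `γ` runs inside the hot set `H = {y₂ = 0, f = M}` near `s₀`, with `D²f(γ s₀)[γ′ s₀, ·] = 0` and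
  horizontal Laplacian `−κ ≠ 0` at hot points, then every hot point close to `γ s₀` lies ON `γ` (Mathlib's implicit function theorem `ContDiffAt.implicitFunction` for
  `∂_ν f(h + aT + nν) = 0`, `∂ₙ = D²f(h)[ν,ν] = −κ`; the graph coordinate `a(s) = ⟪γ s − h, T⟫` has `a′(s₀) = 1`, so `γ` sweeps the graph by the intermediate value theorem);
* `deriv_apply_two_eq_zero`, `hessian_apply_deriv_eq_zero_of_hot` — tangents of hot curves are horizontal kernel vectors of the Hessian;
* `hasDerivAt_goodCurve` — every `C²` unit-speed curve inside `H` solves `Z′ = branchField f κ Z` with `Z = (γ, γ′)` (jet relations by differentiating `Df(γ) ≡ 0`,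
  `D²f(γ)[γ′, w] ≡ 0`, `‖γ′‖² ≡ 1`, `γ₂ ≡ 0`, then `…Frame.accel_eq_of_jets`), hence is subject to ODE uniqueness (`…ODE.eqOn_of_solutions`).

WHAT THIS IS NOT: not a claim about Navier–Stokes regularity — calculus for the entrance of research cell (Q4) (bears_on LADDER-NS N0, item 20428 / crux 19708; OPEN).
-/

noncomputable section

set_option linter.style.longLine false
-- the summit and its single sub-problem share the name (CONVENTIONS §1), as in every Theorems file
set_option linter.dupNamespace false

namespace Summit.NavierStokesRegularity.NavierStokesRegularity.Theorems.PoloidalWindowDoorLrcModEntireRidgeGlobalBranchUnique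

open Set Filter Topology Metric Function
open scoped NNReal InnerProductSpace RealInnerProductSpace ContDiff
open Summit.NavierStokesRegularity.NavierStokesRegularity.Theorems.PoloidalWindowDoorLrcModEntireRidgeGlobalBranchODE
open Summit.NavierStokesRegularity.NavierStokesRegularity.Theorems.PoloidalWindowDoorLrcModEntireRidgeGlobalBranchFrame
open Summit.NavierStokesRegularity.NavierStokesRegularity.Theorems.PoloidalWindowDoorLrcModEntireRidgeGlobalBranchLocal

variable {f : EuclideanSpace ℝ (Fin 3) → ℝ} {κ M : ℝ}

/-- **LOCAL UNIQUENESS OF THE HOT ARC.**  See the module docstring. -/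
theorem hotSet_subset_curve (hf2 : ContDiff ℝ 2 f) (hκ : κ ≠ 0)
    (hcrit : ∀ y : EuclideanSpace ℝ (Fin 3), y 2 = 0 → f y = M → fderiv ℝ f y = 0)
    (htr : ∀ y : EuclideanSpace ℝ (Fin 3), y 2 = 0 → f y = M → fderiv ℝ (fderiv ℝ f) y e0 e0 + fderiv ℝ (fderiv ℝ f) y e1 e1 = -κ)
    {γ : ℝ → EuclideanSpace ℝ (Fin 3)} {s₀ ε : ℝ} (hε : 0 < ε)
    (hγd : ∀ s ∈ Ioo (s₀ - ε) (s₀ + ε), HasDerivAt γ (deriv γ s) s) (hγc : ContinuousAt (deriv γ) s₀)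
    (hγ2 : ∀ s ∈ Ioo (s₀ - ε) (s₀ + ε), γ s 2 = 0) (hγM : ∀ s ∈ Ioo (s₀ - ε) (s₀ + ε), f (γ s) = M)
    (hT2 : deriv γ s₀ 2 = 0) (hT1 : ‖deriv γ s₀‖ = 1) (hker : ∀ w, fderiv ℝ (fderiv ℝ f) (γ s₀) (deriv γ s₀) w = 0) :
    ∃ ρ > 0, ∀ y : EuclideanSpace ℝ (Fin 3), y 2 = 0 → f y = M → dist y (γ s₀) < ρ → ∃ s ∈ Ioo (s₀ - ε) (s₀ + ε), γ s = y := by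
  set h := γ s₀ with hhdef
  set T := deriv γ s₀ with hTdef
  obtain ⟨hν2, hν1, hTν, hνT⟩ := rotJ_facts hT2 hT1
  set ν := rotJ T with hνdef
  have hs₀ : s₀ ∈ Ioo (s₀ - ε) (s₀ + ε) := ⟨by linarith, by linarith⟩
  have hh2 : h 2 = 0 := hγ2 s₀ hs₀
  have hhM : f h = M := hγM s₀ hs₀
  have hDf : ∀ x, HasFDerivAt (fderiv ℝ f) (fderiv ℝ (fderiv ℝ f) x) x := fun x =>
    (((hf2.fderiv_right (m := 1) (by norm_num)).differentiable one_ne_zero) x).hasFDerivAt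
  have hνν : fderiv ℝ (fderiv ℝ f) h ν ν = -κ := by
    have hft := frame_trace (fderiv ℝ (fderiv ℝ f) h) hT2 hT1
    rw [hker T, htr h hh2 hhM] at hft
    linarith
  -- ### the implicit equation and its solution `φ`
  set A : ℝ × ℝ → EuclideanSpace ℝ (Fin 3) := fun q => h + q.1 • T + q.2 • ν with hAdef
  set F : ℝ × ℝ → ℝ := fun q => fderiv ℝ f (A q) ν with hFdef
  have hA0 : A (0, 0) = h := by simp [hAdef]
  set Aℓ : ℝ × ℝ →L[ℝ] EuclideanSpace ℝ (Fin 3) :=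
    (ContinuousLinearMap.fst ℝ ℝ ℝ).smulRight T + (ContinuousLinearMap.snd ℝ ℝ ℝ).smulRight ν with hAℓ
  have hAd : ∀ q, HasFDerivAt A Aℓ q := fun q => by
    have h1 : HasFDerivAt (fun q : ℝ × ℝ => q.1 • T) ((ContinuousLinearMap.fst ℝ ℝ ℝ).smulRight T) q :=
      (ContinuousLinearMap.fst ℝ ℝ ℝ).hasFDerivAt.smul_const T
    have h2 : HasFDerivAt (fun q : ℝ × ℝ => q.2 • ν) ((ContinuousLinearMap.snd ℝ ℝ ℝ).smulRight ν) q :=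
      (ContinuousLinearMap.snd ℝ ℝ ℝ).hasFDerivAt.smul_const ν
    rw [hAdef, hAℓ]
    exact (h1.const_add h).add h2
  have hAcd : ContDiff ℝ 1 A := by
    rw [hAdef]
    exact (contDiff_const.add (contDiff_fst.smul contDiff_const)).add (contDiff_snd.smul contDiff_const)
  have hgν : ContDiff ℝ 1 (fun x => fderiv ℝ f x ν) := (hf2.fderiv_right (m := 1) (by norm_num)).clm_apply contDiff_const
  have hF1 : ContDiffAt ℝ 1 F (0, 0) := (hgν.comp hAcd).contDiffAt
  have hF00 : F (0, 0) = 0 := by simp only [hFdef, hA0, hcrit h hh2 hhM, zero_apply]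
  have hgνd : HasFDerivAt (fun x => fderiv ℝ f x ν)
      ((fderiv ℝ f (A (0, 0))).comp (0 : EuclideanSpace ℝ (Fin 3) →L[ℝ] EuclideanSpace ℝ (Fin 3)) +
        (fderiv ℝ (fderiv ℝ f) (A (0, 0))).flip ν) (A (0, 0)) :=
    (hDf (A (0, 0))).clm_apply (hasFDerivAt_const ν (A (0, 0)))
  have hFd : HasFDerivAt F (((fderiv ℝ f (A (0, 0))).comp (0 : EuclideanSpace ℝ (Fin 3) →L[ℝ] EuclideanSpace ℝ (Fin 3)) +
        (fderiv ℝ (fderiv ℝ f) (A (0, 0))).flip ν).comp Aℓ) (0, 0) := hgνd.comp (0, 0) (hAd (0, 0))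
  have hinv : (fderiv ℝ F (0, 0) ∘L ContinuousLinearMap.inr ℝ ℝ ℝ).IsInvertible := by
    refine Literature.Topology.FourManifolds.isInvertible_of_apply_one_ne_zero _ ?_
    rw [hFd.fderiv, hA0]
    simp [hAℓ, hνν, hκ]
  have h10 : (1 : ℕ∞ω) ≠ 0 := one_ne_zero
  set φ : ℝ → ℝ := hF1.implicitFunction h10 hinv with hφdef
  have hiff : ∀ᶠ q in 𝓝 ((0 : ℝ), (0 : ℝ)), F q = F (0, 0) ↔ φ q.1 = q.2 := hF1.eventually_apply_eq_iff_implicitFunction h10 hinv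
  obtain ⟨δ₁, hδ₁, hiff'⟩ := Metric.eventually_nhds_iff.1 hiff
  -- hot points near `h`, in graph coordinates, satisfy `φ a = n`
  have hgraph : ∀ y : EuclideanSpace ℝ (Fin 3), y 2 = 0 → f y = M → dist y h < δ₁ →
      y = h + ⟪y - h, T⟫ • T + ⟪y - h, ν⟫ • ν ∧ φ ⟪y - h, T⟫ = ⟪y - h, ν⟫ := by
    intro y hy2 hyM hyd
    have hw2 : (y - h) 2 = 0 := by simp [hy2, hh2]
    have hexp : y - h = ⟪y - h, T⟫ • T + ⟪y - h, ν⟫ • ν := horiz_expand hw2 hT2 hT1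
    have hyeq : y = h + ⟪y - h, T⟫ • T + ⟪y - h, ν⟫ • ν := by rw [add_assoc, ← hexp]; abel
    have hq : dist ((⟪y - h, T⟫, ⟪y - h, ν⟫) : ℝ × ℝ) (0, 0) < δ₁ := by
      have ha : |⟪y - h, T⟫| ≤ ‖y - h‖ := by have := abs_real_inner_le_norm (y - h) T; rwa [hT1, mul_one] at this
      have hn : |⟪y - h, ν⟫| ≤ ‖y - h‖ := by have := abs_real_inner_le_norm (y - h) ν; rwa [hν1, mul_one] at this
      rw [Prod.dist_eq, Real.dist_eq, Real.dist_eq, sub_zero, sub_zero, ← dist_eq_norm] at *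
      exact max_lt (ha.trans_lt hyd) (hn.trans_lt hyd)
    have hFq : F (⟪y - h, T⟫, ⟪y - h, ν⟫) = F (0, 0) := by
      rw [hF00]; simp only [hFdef, hAdef]
      rw [← hyeq, hcrit y hy2 hyM, zero_apply]
    exact ⟨hyeq, (hiff' hq).1 hFq⟩
  -- ### the graph coordinate `a(s) = ⟪γ s − h, T⟫` along `γ` is increasing through `0`
  set a : ℝ → ℝ := fun s => ⟪γ s - h, T⟫ with hadef
  have had : ∀ s ∈ Ioo (s₀ - ε) (s₀ + ε), HasDerivAt a ⟪deriv γ s, T⟫ s := fun s hs => by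
    have h1 : HasDerivAt (fun s => γ s - h) (deriv γ s) s := (hγd s hs).sub_const h
    have h2 := h1.inner ℝ (hasDerivAt_const s T)
    simpa [hadef] using h2
  have ha0 : a s₀ = 0 := by simp [hadef, hhdef]
  -- continuity of `⟪γ′, T⟫` at `s₀` with value `1`
  have hcont : ContinuousAt (fun s => ⟪deriv γ s, T⟫) s₀ := hγc.inner continuousAt_const
  have hval : ⟪deriv γ s₀, T⟫ = 1 := by rw [← hTdef, real_inner_self_eq_norm_sq, hT1]; norm_num
  have hhalf : ∀ᶠ s in 𝓝 s₀, 1 / 2 < ⟪deriv γ s, T⟫ := hcont.eventually (lt_mem_nhds (by show (1:ℝ)/2 < ⟪deriv γ s₀, T⟫; rw [hval]; norm_num))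
  have hnear : ∀ᶠ s in 𝓝 s₀, dist (γ s) h < δ₁ := by
    have hγc0 : ContinuousAt γ s₀ := (hγd s₀ hs₀).continuousAt
    have : ∀ᶠ s in 𝓝 s₀, γ s ∈ ball h δ₁ := hγc0.preimage_mem_nhds (by rw [← hhdef]; exact ball_mem_nhds _ hδ₁)
    exact this
  obtain ⟨η, hη, hηall⟩ := Metric.eventually_nhds_iff.1 (hhalf.and (hnear.and (Ioo_mem_nhds hs₀.1 hs₀.2 : Ioo (s₀ - ε) (s₀ + ε) ∈ 𝓝 s₀)))
  set η' := η / 2 with hη'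
  have hη'0 : 0 < η' := by positivity
  have hIcc : ∀ s ∈ Icc (s₀ - η') (s₀ + η'), 1 / 2 < ⟪deriv γ s, T⟫ ∧ dist (γ s) h < δ₁ ∧ s ∈ Ioo (s₀ - ε) (s₀ + ε) := fun s hs =>
    hηall (by rw [Real.dist_eq, abs_lt]; constructor <;> linarith [hs.1, hs.2])
  have hacont : ContinuousOn a (Icc (s₀ - η') (s₀ + η')) := fun s hs => (had s (hIcc s hs).2.2).continuousAt.continuousWithinAt
  have hadiff : DifferentiableOn ℝ a (interior (Icc (s₀ - η') (s₀ + η'))) := fun s hs => by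
    rw [interior_Icc] at hs
    exact (had s (hIcc s (Ioo_subset_Icc_self hs)).2.2).differentiableAt.differentiableWithinAt
  have haderiv : ∀ s ∈ interior (Icc (s₀ - η') (s₀ + η')), (1 / 2 : ℝ) ≤ deriv a s := fun s hs => by
    rw [interior_Icc] at hs
    rw [(had s (hIcc s (Ioo_subset_Icc_self hs)).2.2).deriv]
    exact (hIcc s (Ioo_subset_Icc_self hs)).1.le
  have hmono := (convex_Icc (s₀ - η') (s₀ + η')).mul_sub_le_image_sub_of_le_deriv hacont hadiff haderiv
  have hlo : a (s₀ - η') ≤ -(η' / 2) := by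
    have := hmono (s₀ - η') ⟨le_rfl, by linarith⟩ s₀ ⟨by linarith, by linarith⟩ (by linarith)
    rw [ha0] at this; linarith
  have hhi : η' / 2 ≤ a (s₀ + η') := by
    have := hmono s₀ ⟨by linarith, by linarith⟩ (s₀ + η') ⟨by linarith, le_rfl⟩ (by linarith)
    rw [ha0] at this; linarith
  -- ### conclusion: `ρ := min δ₁ (η'/2)`
  refine ⟨min δ₁ (η' / 2), lt_min hδ₁ (by positivity), fun y hy2 hyM hyd => ?_⟩
  obtain ⟨hyeq, hφy⟩ := hgraph y hy2 hyM (hyd.trans_le (min_le_left _ _))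
  have hay : |⟪y - h, T⟫| < η' / 2 := by
    have := abs_real_inner_le_norm (y - h) T
    rw [hT1, mul_one, ← dist_eq_norm] at this
    exact this.trans_lt (hyd.trans_le (min_le_right _ _))
  have hmem : ⟪y - h, T⟫ ∈ Icc (a (s₀ - η')) (a (s₀ + η')) := by
    constructor <;> linarith [(abs_lt.1 hay).1, (abs_lt.1 hay).2]
  obtain ⟨s, hs, has⟩ := intermediate_value_Icc (by linarith) hacont hmem
  obtain ⟨-, hsd, hsI⟩ := hIcc s hs
  refine ⟨s, hsI, ?_⟩
  obtain ⟨hseq, hφs⟩ := hgraph (γ s) (hγ2 s hsI) (hγM s hsI) hsd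
  have has' : ⟪γ s - h, T⟫ = ⟪y - h, T⟫ := has
  rw [hseq, hyeq, ← hφs, ← hφy, has']

/-- The tangent of a `C¹` curve inside the plane `{y₂ = 0}` is horizontal. -/
theorem deriv_apply_two_eq_zero {g : ℝ → EuclideanSpace ℝ (Fin 3)} {g' : EuclideanSpace ℝ (Fin 3)} {t : ℝ} (hg : HasDerivAt g g' t)
    (hz : ∀ t, g t 2 = 0) : g' 2 = 0 := by
  have h1 : HasDerivAt (fun t => g t 2) (g' 2) t :=
    (EuclideanSpace.proj (2 : Fin 3) : EuclideanSpace ℝ (Fin 3) →L[ℝ] ℝ).hasFDerivAt.comp_hasDerivAt t hg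
  have h0 : HasDerivAt (fun t => g t 2) 0 t := by
    have : (fun t => g t 2) = fun _ => (0 : ℝ) := funext hz
    rw [this]; exact hasDerivAt_const t 0
  exact h1.unique h0

/-- Along a differentiable curve inside the (critical) hot set, the tangent is in the kernel of the Hessian: `D²f(γ t)[γ′ t, ·] = 0`. -/
theorem hessian_apply_deriv_eq_zero_of_hot (hf2 : ContDiff ℝ 2 f)
    (hcrit : ∀ y : EuclideanSpace ℝ (Fin 3), y 2 = 0 → f y = M → fderiv ℝ f y = 0)
    {γ : ℝ → EuclideanSpace ℝ (Fin 3)} {γ' : EuclideanSpace ℝ (Fin 3)} {t : ℝ} (hγ : HasDerivAt γ γ' t)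
    (hplane : ∀ s, γ s 2 = 0) (hhot : ∀ s, f (γ s) = M) (w : EuclideanSpace ℝ (Fin 3)) :
    fderiv ℝ (fderiv ℝ f) (γ t) γ' w = 0 := by
  have hDf : HasFDerivAt (fderiv ℝ f) (fderiv ℝ (fderiv ℝ f) (γ t)) (γ t) :=
    (((hf2.fderiv_right (m := 1) (by norm_num)).differentiable one_ne_zero) (γ t)).hasFDerivAt
  have hzero : (fun b => fderiv ℝ f (γ b)) = fun _ => (0 : EuclideanSpace ℝ (Fin 3) →L[ℝ] ℝ) :=
    funext fun b => hcrit (γ b) (hplane b) (hhot b)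
  have hd1 : HasDerivAt (fun b => fderiv ℝ f (γ b)) (fderiv ℝ (fderiv ℝ f) (γ t) γ') t := hDf.comp_hasDerivAt t hγ
  have hd0 : HasDerivAt (fun b => fderiv ℝ f (γ b)) (0 : EuclideanSpace ℝ (Fin 3) →L[ℝ] ℝ) t := by
    rw [hzero]; exact hasDerivAt_const t _
  rw [hd1.unique hd0, zero_apply]

/-- **EVERY GOOD CURVE SOLVES THE HOT-BRANCH ODE.**  See the module docstring. -/
theorem hasDerivAt_goodCurve (hfa : AnalyticOnNhd ℝ f univ) (hκ : κ ≠ 0)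
    (hcrit : ∀ y : EuclideanSpace ℝ (Fin 3), y 2 = 0 → f y = M → fderiv ℝ f y = 0)
    (htr : ∀ y : EuclideanSpace ℝ (Fin 3), y 2 = 0 → f y = M → fderiv ℝ (fderiv ℝ f) y e0 e0 + fderiv ℝ (fderiv ℝ f) y e1 e1 = -κ)
    {γ : ℝ → EuclideanSpace ℝ (Fin 3)} (hγ2 : ContDiff ℝ 2 γ) (hplane : ∀ s, γ s 2 = 0) (hhot : ∀ s, f (γ s) = M)
    (hunit : ∀ s, ‖deriv γ s‖ = 1) (s : ℝ) :
    HasDerivAt (fun t => (γ t, deriv γ t)) (branchField f κ (γ s, deriv γ s)) s := by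
  have hf : ContDiff ℝ ω f := contDiff_iff_contDiffAt.2 fun x => (hfa x (mem_univ x)).contDiffAt
  have hf3 : ContDiff ℝ 3 f := hf.of_le le_top
  have hDf : ∀ x, HasFDerivAt (fderiv ℝ f) (fderiv ℝ (fderiv ℝ f) x) x := fun x =>
    (((hf.fderiv_right (m := 1) le_top).differentiable one_ne_zero) x).hasFDerivAt
  have hDfd : ∀ x, DifferentiableAt ℝ (fderiv ℝ f) x := fun x => (hDf x).differentiableAt
  have hg : ∀ w : EuclideanSpace ℝ (Fin 3), ContDiff ℝ ω (fun x => fderiv ℝ f x w) := fun w =>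
    (hf.fderiv_right (m := ω) le_top).clm_apply contDiff_const
  have hk2 : ∀ w x, HasFDerivAt (fderiv ℝ (fun x => fderiv ℝ f x w)) (fderiv ℝ (fderiv ℝ (fun x => fderiv ℝ f x w)) x) x :=
    fun w x => ((((hg w).fderiv_right (m := 1) le_top).differentiable one_ne_zero) x).hasFDerivAt
  have hsymm : ∀ x, fderiv ℝ (fderiv ℝ f) x e0 e1 = fderiv ℝ (fderiv ℝ f) x e1 e0 := fun x =>
    (hf.contDiffAt (x := x)).isSymmSndFDerivAt (by simp) e0 e1
  -- derivatives of `γ` and `γ′`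
  have hγ1 : ContDiff ℝ 1 (deriv γ) := by
    have h2 := hγ2
    rw [show (2 : WithTop ℕ∞) = 1 + 1 by norm_num, contDiff_succ_iff_deriv] at h2
    exact h2.2.2
  have hγd : ∀ t, HasDerivAt γ (deriv γ t) t := fun t => ((hγ2.differentiable (by norm_num)) t).hasDerivAt
  have hγ'd : ∀ t, HasDerivAt (deriv γ) (deriv (deriv γ) t) t := fun t => ((hγ1.differentiable one_ne_zero) t).hasDerivAt
  -- horizontality of `γ′` and `γ″`; the tangent is in the kernel of the Hessian
  have hu2all : ∀ t, deriv γ t 2 = 0 := fun t => deriv_apply_two_eq_zero (hγd t) hplane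
  have hu2 : deriv γ s 2 = 0 := hu2all s
  have hu'2 : deriv (deriv γ) s 2 = 0 := deriv_apply_two_eq_zero (hγ'd s) hu2all
  have hkerall : ∀ t w, fderiv ℝ (fderiv ℝ f) (γ t) (deriv γ t) w = 0 := fun t w =>
    hessian_apply_deriv_eq_zero_of_hot (hf.of_le le_top) hcrit (hγd t) hplane hhot w
  -- (i) differentiate `D²f(γ)[γ′, w] ≡ 0`
  have hq : ∀ w, fderiv ℝ (fderiv ℝ (fderiv ℝ f)) (γ s) (deriv γ s) (deriv γ s) w + fderiv ℝ (fderiv ℝ f) (γ s) (deriv (deriv γ) s) w = 0 := by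
    intro w
    have hB : HasDerivAt (fun t => fderiv ℝ (fun x => fderiv ℝ f x w) (γ t))
        (fderiv ℝ (fderiv ℝ (fun x => fderiv ℝ f x w)) (γ s) (deriv γ s)) s := (hk2 w (γ s)).comp_hasDerivAt s (hγd s)
    have hΦ := hB.clm_apply (hγ'd s)
    have hzero : (fun t => fderiv ℝ (fun x => fderiv ℝ f x w) (γ t) (deriv γ t)) = fun _ => (0 : ℝ) := by
      funext t
      rw [fderiv_fderiv_apply_const (hDfd _), hkerall t w]
    have hΦ0 : HasDerivAt (fun t => fderiv ℝ (fun x => fderiv ℝ f x w) (γ t) (deriv γ t)) (0 : ℝ) s := by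
      rw [hzero]; exact hasDerivAt_const s 0
    have heq := hΦ.unique hΦ0
    rw [fderiv_fderiv_fderiv_apply_const hf3, fderiv_fderiv_apply_const (hDfd _)] at heq
    rw [fderiv3_eq_iteratedFDeriv hf3]
    exact heq
  -- (ii) `‖γ′‖² ≡ 1 ⇒ ⟪γ′, γ″⟫ = 0`
  have horth : ⟪deriv γ s, deriv (deriv γ) s⟫ = 0 := by
    have h1 : HasDerivAt (fun t => ‖deriv γ t‖ ^ 2) (2 * ⟪deriv γ s, deriv (deriv γ) s⟫) s := (hγ'd s).norm_sq
    have h0 : HasDerivAt (fun t => ‖deriv γ t‖ ^ 2) 0 s := by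
      have : (fun t => ‖deriv γ t‖ ^ 2) = fun _ => (1 : ℝ) := funext fun t => by rw [hunit t, one_pow]
      rw [this]; exact hasDerivAt_const s 1
    have := h1.unique h0
    linarith
  -- ### the acceleration identity
  have hacc := accel_eq_of_jets (fderiv ℝ (fderiv ℝ f) (γ s)) hu2 (hunit s) hu'2 horth hκ (hsymm _) (hkerall s)
    (htr _ (hplane s) (hhot s)) (fderiv ℝ (fderiv ℝ (fderiv ℝ f)) (γ s) (deriv γ s) (deriv γ s)) hq
  have hval : branchField f κ (γ s, deriv γ s) = (deriv γ s, deriv (deriv γ) s) := by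
    refine Prod.ext ?_ ?_
    · rw [branchField_fst]; exact clip_of_norm_eq_one (hunit s)
    · rw [branchField_snd, hacc]
      simp only [accel, D3n_eq_fderiv3 hf3 (hunit s), ← fderiv_fderiv_eq_D2c]
  rw [hval]
  exact (hγd s).prodMk (hγ'd s)

end Summit.NavierStokesRegularity.NavierStokesRegularity.Theorems.PoloidalWindowDoorLrcModEntireRidgeGlobalBranchUnique

end
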